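import Summits.ResolutionOfSingularities.ResolutionOfSingularities.Theorems.FrobeniusClosingPatchingRelPerfectDepthMultiHostFormatSnc
import HarnessLib

/-!
# Crux `PatchingRelPerfect` (stmt-ResolutionOfSingularities-16161), chain W5.2 — F7(β) d = 2 (β-AX) A1: E2′ — FORMAT-SNC END on `U` is kept by
# a `step` whose centre MISSES `U` (Phase C moves inside the frozen private pieces keep the cylinder side)

[OURS · L1 W5.2 · F7(β) (β-AX) X-side · res-L1-w52-plan-1 RULING G11-17 (2)(iii) «E2′ (centre disjoint from U) LAST — only T3΄s bookkeeping
consumes it»; companion of E2 `IsFormatSncOn.step` (p546954, centre meeting `U` in a stratum).]  Replaces the role of NO printed item; NOT a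
statement of the manuscript under review; fact-free.  AI-written; AI review is weaker than expert review.  No definitions.

## Contents (namespace `…Theorems.DepthMultiHost`)
* `controlledTransform_top_centre`, `strictTransformIdeal_top_centre` — along ANY morphism, the transforms with centre the unit ideal are
  the total transform (`(σ^*I : ⊤^μ) = σ^*I`).
* `hasSNCWith_append_top` — appending the unit ideal (empty support) to an snc family.
* `comap_ι_eq_top_of_disjoint` — `𝓘_W|_U = ⊤` when `W ∩ U = ∅`.
* **E2′ `MultiHostState.IsFormatSncOn.step_of_disjoint`** — if `S` is format-snc END on `U` and `W ∩ U = ∅`, then for every `step` at `W`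
  (any `η`, `m`, `ν`) and ANY exceptional exponents `e i` the successor is format-snc END on `τ⁻¹ U` with components `𝓒.map st` and host
  lists `(𝓗 i).map (st × id) ++ [(F, e i)]` — the SAME successor shape as E2 (take `e i := weightAt (𝓗 i) η − m i`).  Over `U` the
  blowing up is an isomorphism (Görtz–Wedhorn Prop. 13.91 (3), tree `IsBlowup.isIso_morphismRestrict`), `F|_{τ⁻¹U} = ⊤`, strict and
  controlled transforms restrict to total transforms (`BlowupRestrictOpen` kit with centre `𝓘_W|_U = ⊤`), and snc pulls back along
  the open immersion `τ ∣_ U`.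

## References
* U. Görtz, T. Wedhorn, *Algebraic Geometry I* (2nd ed., 2020), Prop. 13.91 (1)–(3). [GortzWedhorn2020]
* E. Bierstone, D. Grigoriev, P. Milman, J. Włodarczyk (2011), Def. 3.1.1, Def. 3.1.3 (3)–(5), Thm. 8.0.5. [BierstoneGrigorievMilmanWlodarczyk2011]
* J. Kollár, *Lectures on Resolution of Singularities* (2007), (3.111) Steps 1–3. [Kollar2007]
-/

-- `Summit.<Summit>.<Sub>.Theorems` with `Sub = Summit` (single-conjunct summit, D-0017)
set_option linter.dupNamespace false

noncomputable section

open CategoryTheory AlgebraicGeometry TopologicalSpace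
open Literature.AlgebraicGeometry.Resolution
open Literature.AlgebraicGeometry.Hironaka2017.MonomialPart
open Scheme.IdealSheafData

namespace Summit.ResolutionOfSingularities.ResolutionOfSingularities.Theorems.DepthMultiHost

universe u

variable {X X' : Scheme.{u}}

/-! ## §1 Transforms with centre the unit ideal; small helpers -/

/-- Powers of the unit ideal sheaf. [folklore] -/
theorem top_pow_eq_top (n : ℕ) : (⊤ : X.IdealSheafData) ^ n = ⊤ := by
  rw [← Scheme.IdealSheafData.one_eq_top, one_pow]

/-- **Controlled transform with centre `⊤` = total transform**: `(σ^*I : ⊤^μ) = σ^*I`. [cite: BierstoneGrigorievMilmanWlodarczyk2011, Def. 3.1.3 (3)] -/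
theorem controlledTransform_top_centre (σ : X' ⟶ X) (I : X.IdealSheafData) (μ : ℕ) :
    controlledTransform σ ⊤ I μ = I.comap σ := by
  unfold controlledTransform
  rw [Scheme.IdealSheafData.comap_top, top_pow_eq_top, colon_top]

/-- **Strict transform with centre `⊤` = total transform**: `⋃ₙ (σ^*K : ⊤ⁿ) = σ^*K`. [cite: GortzWedhorn2020, (13.19)] -/
theorem strictTransformIdeal_top_centre (σ : X' ⟶ X) (K : X.IdealSheafData) : strictTransformIdeal σ ⊤ K = K.comap σ := by
  unfold strictTransformIdeal
  simp_rw [Scheme.IdealSheafData.comap_top, top_pow_eq_top, colon_top]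
  exact iSup_const

/-- **Appending the unit ideal** (empty support) keeps simple normal crossings. [cite: BierstoneGrigorievMilmanWlodarczyk2011, Def. 3.1.1] -/
theorem hasSNCWith_append_top {E : List X.IdealSheafData} {C : X.IdealSheafData} (h : HasSNCWith E C) : HasSNCWith (E ++ [⊤]) C := by
  intro x
  obtain ⟨hreg, u, hu, ⟨ι, hι, hιD⟩, hC⟩ := h x
  have hmem : ∀ D : {D : X.IdealSheafData // D ∈ E ++ [⊤] ∧ x ∈ D.support}, D.1 ∈ E := by
    intro D
    rcases List.mem_append.mp D.2.1 with hD | hD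
    · exact hD
    · exfalso
      have hx := D.2.2
      rw [List.mem_singleton.mp hD, Scheme.IdealSheafData.support_top] at hx
      exact hx
  refine ⟨hreg, u, hu, ⟨fun D => ι ⟨D.1, hmem D, D.2.2⟩, fun D₁ D₂ heq => ?_, fun D => hιD ⟨D.1, hmem D, D.2.2⟩⟩, hC⟩
  have e := congrArg Subtype.val (hι heq)
  exact Subtype.ext e

/-- **`𝓘_W|_U = ⊤` when the closed set `W` misses the open `U`.** [folklore] -/
theorem comap_ι_vanishingIdeal_eq_top_of_disjoint {W : Closeds X} {U : X.Opens} (hWU : Disjoint (W : Set X) (U : Set X)) :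
    (vanishingIdeal W).comap U.ι = ⊤ := by
  rw [← Scheme.IdealSheafData.support_eq_bot_iff, Scheme.IdealSheafData.support_comap]
  ext x
  simp only [Closeds.coe_preimage, Set.mem_preimage, Closeds.coe_bot, Set.mem_empty_iff_false, iff_false,
    Scheme.IdealSheafData.coe_support_vanishingIdeal]
  exact fun hx => Set.disjoint_left.mp hWU hx x.2

/-! ## §2 E2′: a step whose centre misses `U` -/

namespace MultiHostState

variable [IsLocallyNoetherian X] {S : MultiHostState X} {U : X.Opens} {𝓒 : List X.IdealSheafData}
  {𝓗 : Fin S.n → List (X.IdealSheafData × ℕ)} {τ : X' ⟶ X} {W : Closeds X}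

/-- **E2′ (res-L1-w52-plan-1 RULING G11-17 (2)(iii)): FORMAT-SNC END IS KEPT BY A STEP WHOSE CENTRE MISSES `U`.**  If `S` is format-snc END on
`U` (`𝓒`, `𝓗`) and the centre `W` of a step `S.step τ W η m ν` is disjoint from `U`, then for ANY exceptional exponents `e i` the successor
is format-snc END on `τ⁻¹ U` with components `𝓒.map st` and host lists `(𝓗 i).map (st × id) ++ [(F, e i)]` (same shape as E2
`IsFormatSncOn.step`; on `τ⁻¹ U` the exceptional member is the unit ideal, so its exponent is immaterial).  Over `U` the blowing up is an
isomorphism, transforms are total transforms, and snc pulls back along the open immersion `τ ∣_ U`.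
[cite: GortzWedhorn2020, Prop. 13.91 (3)] [cite: BierstoneGrigorievMilmanWlodarczyk2011, Def. 3.1.3 (3)–(5), Thm. 8.0.5] -/
theorem IsFormatSncOn.step_of_disjoint (h : S.IsFormatSncOn U 𝓒 𝓗) (hsnc : HasSNCWith S.𝓔 (vanishingIdeal W))
    (hτ : IsBlowup τ (vanishingIdeal W)) (η : X) (m : Fin S.n → ℕ) (ν : ℕ) (e : Fin S.n → ℕ)
    (hWU : Disjoint (W : Set X) (U : Set X)) :
    (S.step τ W η m ν hsnc hτ).IsFormatSncOn (τ ⁻¹ᵁ U) (𝓒.map (strictTransformIdeal τ (vanishingIdeal W)))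
      fun i => ((𝓗 i).map fun p => (strictTransformIdeal τ (vanishingIdeal W) p.1, p.2)) ++ [((vanishingIdeal W).comap τ, e i)] := by
  haveI : IsProper τ := hτ.isProper
  haveI : IsLocallyNoetherian X' := LocallyOfFiniteType.isLocallyNoetherian τ
  have hI : (vanishingIdeal W).comap U.ι = ⊤ := comap_ι_vanishingIdeal_eq_top_of_disjoint hWU
  haveI : IsIso (τ ∣_ U) := hτ.isIso_morphismRestrict (by
    rw [Scheme.IdealSheafData.coe_support_vanishingIdeal]
    exact hWU.symm)
  -- the transforms restricted to `τ⁻¹ U` are total transforms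
  have hst : ∀ H : X.IdealSheafData,
      (strictTransformIdeal τ (vanishingIdeal W) H).comap (τ ⁻¹ᵁ U).ι = (H.comap τ).comap (τ ⁻¹ᵁ U).ι := by
    intro H
    rw [← strictTransformIdeal_morphismRestrict, hI, strictTransformIdeal_top_centre, comap_comap_morphismRestrict]
  have hF : ((vanishingIdeal W).comap τ).comap (τ ⁻¹ᵁ U).ι = ⊤ := by
    rw [← comap_comap_morphismRestrict, hI, Scheme.IdealSheafData.comap_top]
  refine ⟨fun i => ?_, ?_, fun i => ?_⟩
  · rw [DepthTargets.boundaryOf_map_strictTransform_append, h.boundaryOf_eq i, step_𝓔, List.map_append, List.append_assoc]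
  · -- snc on `τ⁻¹ U`: pull back along the open immersion `τ ∣_ U`, append the unit ideal
    have h1 := hasSNCWith_append_top (HasSNCWith.comap_of_isOpenImmersion (τ ∣_ U) h.hasSNC)
    rw [Scheme.IdealSheafData.comap_top, List.map_map] at h1
    rw [step_𝓔, ← List.append_assoc, ← List.map_append, List.map_append, List.map_map, List.map_singleton, hF]
    refine (List.map_congr_left fun F _ => ?_) ▸ h1
    simp only [Function.comp_apply]
    rw [hst, comap_comap_morphismRestrict]
  · -- hosts: total transforms on both sides
    rw [step_host, ← controlledTransform_morphismRestrict, hI, controlledTransform_top_centre, h.host_eq i,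
      comap_comap_morphismRestrict, monomialIdeal_append, comap_mul, monomialIdeal_singleton, comap_pow, hF, top_pow_eq_top,
      Scheme.IdealSheafData.mul_top, DepthTargets.comap_monomialIdeal_eq_map (𝓗 i) τ, DepthTargets.comap_monomialIdeal_eq_map,
      DepthTargets.comap_monomialIdeal_eq_map, List.map_map, List.map_map]
    congr 1
    refine List.map_congr_left fun p _ => ?_
    simp only [Function.comp_apply, hst]

end MultiHostState

end Summit.ResolutionOfSingularities.ResolutionOfSingularities.Theorems.DepthMultiHost

end
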